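import Summits.BirchSwinnertonDyer.BirchSwinnertonDyer.Theses.TangentCone
import Summits.BirchSwinnertonDyer.BirchSwinnertonDyer.Theorems.TangentConeEdgeDecayStubTwoVarLowerBound
import Summits.BirchSwinnertonDyer.BirchSwinnertonDyer.Theorems.TangentConeEdgeDecayOfCycOrder
import Literature.NumberTheory.EllipticCurves.GreenbergStevensRatioInterpolationCorrectedProofs
import HarnessLib

/-!
# BirchSwinnertonDyer / TangentCone — crux `EdgeDecay` (stmt-BirchSwinnertonDyer-17608), line `lambda-layer-one`:
# the bridge from the logical core `C⁰` re-threaded through ALL Teichmüller branches (ratio-free)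

Lead `prover-line-stmt-BirchSwinnertonDyer-17608-c1-0` (continuation); skeleton `Cruxes/EdgeDecay/Lines/lambda_layer_one.lean`
(v11). **Why.** The bridges landed by the first lead (`stub_edgeDecay_of_layerOneUnit`, `stub_edgeDecay_of_cycOrderLeRank`)
take as a hypothesis the named fact `greenbergStevens_kitagawa_ratio_interpolation`, flagged MIS-STATED by the
literature-prover (one trivial-branch series evaluated at the off-branch points `y_σ`, `(p-1) ∤ (σ-1)`); its corrected
trivial-branch form cannot serve the crux, whose `∀ odd j ∈ [3, 2J+1]` always contains `j = 3`, off-branch for every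
`p ≥ 5` (eread Reader3). **Repair.** (1) The named fact in ALL-BRANCHES value–norm form,
`greenbergStevens_kitagawa_twoVariable_interpolation_allBranches` (Delbourgo 2008 Thm 4.11 with `ψ = 𝟙` at EVERY even
`j = n-1 ≤ k-2`, organised by the Teichmüller branch `c ≡ n-1 (mod p-1)`; one integral series `F_c` per branch, ONE
period `Ω` per member) — the verbatim generalisation of the tree's trivial-branch fact
`greenbergStevens_kitagawa_twoVariable_interpolation`, which it implies (`greenbergStevens_kitagawa_twoVariable_interpolation_of_allBranches`), and
the `TODO(general form)` of `GreenbergStevensRatioInterpolationCorrectedProofs.lean`; landed as Literature p163226 in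
`Literature/NumberTheory/EllipticCurves/TwoVariablePadicLFunction.lean`. (2) A RATIO-FREE bridge: the
lower bound `1 ≤ ‖ι(Λ(g_k,s)/Λ(g_k,j))‖ · p^{r(m+1)+C}` needs `F_0(x_k, y_s)` from BELOW only (`s ≡ 1 (mod p-1)` by the
line equation; landed dominant-term analysis in the form `stub_twoVarLowerBound`) and the denominators from
ABOVE, `‖Ω‖·‖ι(iʲΛ(g_k,j)/ω)‖ = ‖F_c(x_k, y_j)‖ ≤ 1` by integrality — no identity between branches. Hence
`lambdaLayerOne_decayLeCycOrder_allBranches` (the XL stub "two-variable total decay ≤ cyclotomic order", conditional on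
the all-branches fact and Hida's members) and the registered bridge
`stub_edgeDecay_of_cycOrderLeRank_allBranches : C⁰ → exists_isNewformOf → GS_allBranches → Hida → EdgeDecay`, with C⁰
(`stub_cycOrderLeRankSomewhere`, conjecture-grade, unchanged since v10: an ADMISSIBLE (Br) prime with
`ord_T L_p(f_E, α; T) ≤ r_an`). Disproof.lean (cdisprove v2) respected: `k ≥ 5J + 8 > 4J + 2`, `s` odd,
`Λ(g_k, j) ≠ 0` from `2j + 2 < k` (`IsNewform0.completedLValue_ne_zero_of_two_mul_add_two_lt`).
-/

-- `Summit.BirchSwinnertonDyer.BirchSwinnertonDyer.…`: the summit and its single sub-problem share a name (D-0017 layout).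
set_option linter.dupNamespace false

namespace Summit.BirchSwinnertonDyer.BirchSwinnertonDyer.Theorems

open scoped Classical
open Filter Topology

/-- **Two-variable total decay `≤` cyclotomic order, through all Teichmüller branches** (the XL stub
`stub_gsTotalDecayLeCycOrder` of the crux's lines, now CONDITIONAL on the all-branches fact and on Hida's members
`hida_exists_congruent_ordinary_newform`, and proved WITHOUT any ratio identity): if `ord_T L_p(f_E, α; T) ≤ n` at an
admissible prime `p` with (Br), then along `k = 2 + b t`, `t = 2(p-1)p^{m+m₀}t₀`, `s = 1 + a t` the edge ratios
`R = Λ(g_k,s)/Λ(g_k,j)` of the branch members satisfy `1 ≤ ‖ι R‖ · p^{n(m+1)+C}` for all odd `3 ≤ j ≤ 2J+1`.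
Mechanism: a non-zero coefficient of `L_p` in degree `≤ n` is a non-zero coefficient of `F_0` on the axis
(weight-`2` row), `stub_twoVarLowerBound` bounds `‖F_0(x_k, y_s)‖` from below, the value–norm
interpolation at `n = s` (trivial branch: `(p-1) ∣ (s-1)`) reads it as `‖Ω‖·‖ι(iˢΛ(g,s)/ω)‖` (unit Euler factor,
`norm_eulerFactor_eq_one`), and at `n = j` (branch `(j-1) mod (p-1)`) integrality gives
`‖Ω‖·‖ι(iʲΛ(g,j)/ω)‖ ≤ 1`; with `Λ(g,j) ≠ 0` (`2j + 2 < k`) this is `‖ι R‖ ≥ ‖F_0(x_k, y_s)‖`.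
[cite: GreenbergStevens1993, Thm 5.15] -/
theorem lambdaLayerOne_decayLeCycOrder_allBranches
    (hGS : Literature.NumberTheory.EllipticCurves.greenbergStevens_kitagawa_twoVariable_interpolation_allBranches)
    (hHida : Literature.NumberTheory.EllipticCurves.hida_exists_congruent_ordinary_newform) :
    ∀ (W : WeierstrassCurve ℚ) [W.IsElliptic] [W.IsGloballyMinimal] (_ : NeZero (W.conductorNorm ℤ)) (p : ℕ) [Fact p.Prime], 5 ≤ p → W.HasGoodReductionAtPrime p → ¬ (p : ℤ) ∣ W.frobeniusTrace p → ¬ (p : ℤ) ∣ (W.frobeniusTrace p) ^ 2 - 1 → W.HasSurjectiveModNGaloisRep p → (∀ (M : ℕ) (_ : NeZero M) (g : CuspForm (CongruenceSubgroup.Gamma0 M) 2) (ι : Literature.NumberTheory.EllipticCurves.ModularForms.coeffField g →+* PadicAlgCl p), M ∣ W.conductorNorm ℤ * p → Literature.NumberTheory.EllipticCurves.ModularForms.IsNewform0 g → ‖ι ⟨(UpperHalfPlane.qExpansion 1 ⇑g).coeff p, Literature.NumberTheory.EllipticCurves.ModularForms.coeff_mem_coeffField g p⟩‖ = 1 → (∀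 ℓ : ℕ, ℓ.Prime → ¬ ℓ ∣ W.conductorNorm ℤ * p → ‖ι ⟨(UpperHalfPlane.qExpansion 1 ⇑g).coeff ℓ, Literature.NumberTheory.EllipticCurves.ModularForms.coeff_mem_coeffField g ℓ⟩ - ((W.frobeniusTrace ℓ : ℤ) : PadicAlgCl p)‖ < 1) → M = W.conductorNorm ℤ ∧ ∀ n : ℕ, (UpperHalfPlane.qExpansion 1 ⇑g).coeff n = ((W.LFunction n : ℤ) : ℂ)) → ∀ (f : CuspForm (CongruenceSubgroup.Gamma0 (W.conductorNorm ℤ)) 2), Literature.NumberTheory.EllipticCurves.ModularForms.IsNewformOf W f → ∀ n : ℕ, (Literature.NumberTheory.EllipticCurves.padicLFunction f (Literature.NumberTheory.EllipticCurves.unitRoot W p : ℚ_[p])).order ≤ n → ∃ (a b : ℕ), 0 < b ∧ 2 * a < b ∧ ∀ J : ℕ, ∃ C : ℕ, ∀ m : ℕ, ∃ (k : ℤ) (g : CuspForm (CongruenceSubgroup.Gamma0 (W.conductorNorm ℤ)) k) (ι : Literature.NumberTheory.EllipticCurves.ModularForms.coeffField g →+* PadicAlgCl p) (s : ℕ), (2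 * b * (p - 1) * p ^ m : ℤ) ∣ (k - 2) ∧ (2 * J + 3 : ℤ) ≤ k ∧ (b : ℤ) * ((s : ℤ) - 1) = a * (k - 2) ∧ Literature.NumberTheory.EllipticCurves.ModularForms.IsNewform0 g ∧ ‖ι ⟨(UpperHalfPlane.qExpansion 1 ⇑g).coeff p, Literature.NumberTheory.EllipticCurves.ModularForms.coeff_mem_coeffField g p⟩‖ = 1 ∧ (∀ ℓ : ℕ, ℓ.Prime → ¬ ℓ ∣ W.conductorNorm ℤ * p → ‖ι ⟨(UpperHalfPlane.qExpansion 1 ⇑g).coeff ℓ, Literature.NumberTheory.EllipticCurves.ModularForms.coeff_mem_coeffField g ℓ⟩ - ((W.frobeniusTrace ℓ : ℤ) : PadicAlgCl p)‖ < 1) ∧ ∀ (j : ℕ), Odd j → 3 ≤ j → j ≤ 2 * J + 1 → ∃ hR : (∫ t in Set.Ioi (0 : ℝ), ((t : ℂ) ^ (s - 1)) * g (UpperHalfPlane.ofComplex ((t : ℂ) * Complex.I))) / (∫ t in Set.Ioi (0 : ℝ), ((t : ℂ) ^ (j - 1)) * g (UpperHalfPlane.ofComplex ((t : ℂ) * Complex.I)))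 ∈ Literature.NumberTheory.EllipticCurves.ModularForms.coeffField g, 1 ≤ ‖ι ⟨_, hR⟩‖ * (p : ℝ) ^ (n * (m + 1) + C) := by
  intro W _ _ hN p _ h5 hgood hord hna hsurj hBr f hf n horder
  classical
  haveI := hN
  have hp : p.Prime := Fact.out
  have hp2 : p ≠ 2 := by omega
  have hp1 : (1 : ℝ) < p := by exact_mod_cast hp.one_lt
  have hp1le : 1 ≤ p := hp.one_le
  set α : ℚ_[p] := (Literature.NumberTheory.EllipticCurves.unitRoot W p : ℚ_[p]) with hα
  -- the named fact: the branch series, the weight-`2` row, the interpolation data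
  obtain ⟨F, hFint, hwt2, hinterp⟩ := hGS W hN p h5 hgood hord hsurj hBr
  obtain ⟨c, hc, hcF⟩ := hwt2 f hf
  -- the coefficients of the trivial-branch series as a double sequence
  set G : ℕ → ℕ → ℚ_[p] := fun i j => MvPowerSeries.coeff (Finsupp.single 0 i + Finsupp.single 1 j) (F 0) with hG
  have hGM : ∀ i j : ℕ, ‖G i j‖ ≤ 1 := fun i j => hFint 0 _
  have hG0 : ∀ j : ℕ, G 0 j = c * Literature.NumberTheory.EllipticCurves.padicLCoeff f α j := by
    intro j
    simp only [hG, Finsupp.single_zero, zero_add]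
    rw [hcF j, Literature.NumberTheory.EllipticCurves.coeff_padicLFunction]
  -- a non-zero coefficient of `L_p` in degree `≤ n`
  obtain ⟨j₀, hj₀n, hj₀⟩ : ∃ j₀ : ℕ, j₀ ≤ n ∧
      Literature.NumberTheory.EllipticCurves.padicLCoeff f α j₀ ≠ 0 := by
    by_contra hall
    push Not at hall
    have hle : ((n + 1 : ℕ) : ℕ∞) ≤
        (Literature.NumberTheory.EllipticCurves.padicLFunction f α).order := by
      apply PowerSeries.nat_le_order
      intro i hi
      rw [Literature.NumberTheory.EllipticCurves.coeff_padicLFunction]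
      exact hall i (by omega)
    have h' : ((n + 1 : ℕ) : ℕ∞) ≤ (n : ℕ∞) := hle.trans horder
    have : n + 1 ≤ n := by exact_mod_cast h'
    omega
  have hG0j : G 0 j₀ ≠ 0 := by rw [hG0 j₀]; exact mul_ne_zero hc hj₀
  -- the lower bound along a lattice curve: slope, threshold and constant
  obtain ⟨a, b, hb, hab, m₀, C, hrate⟩ := stub_twoVarLowerBound p hp2 G 1 n hGM ⟨j₀, hj₀n, hG0j⟩
  refine ⟨a, b, hb, hab, fun J => ⟨n * m₀ + C, fun m => ?_⟩⟩
  -- the weight `k = 2 + b t`, `t = 2 (p-1) p^(m+m₀) t₀`, `t₀ = 1 + p (J+1)`, and `s = 1 + a t`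
  set e : ℕ := m + m₀ with he
  set t₀ : ℕ := 1 + p * (J + 1) with ht₀
  set t : ℕ := 2 * (p - 1) * p ^ e * t₀ with ht
  set s : ℕ := 1 + a * t with hs
  set k : ℤ := 2 + (b : ℤ) * (t : ℤ) with hkdef
  have ht₀pos : 0 < t₀ := by positivity
  have hpe : 0 < 2 * (p - 1) * p ^ e := by
    have : 0 < p - 1 := by omega
    positivity
  have htpos : 0 < t := Nat.mul_pos hpe ht₀pos
  have htge : t₀ ≤ t := Nat.le_mul_of_pos_left t₀ hpe
  have ht₀ge : 5 * J + 6 ≤ t₀ := by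
    have : 5 * (J + 1) ≤ p * (J + 1) := Nat.mul_le_mul_right _ h5
    omega
  have htJ : (5 * J + 6 : ℤ) ≤ (t : ℤ) := by exact_mod_cast ht₀ge.trans htge
  have hbt : (t : ℤ) ≤ (b : ℤ) * (t : ℤ) := by
    have hb1 : (1 : ℤ) ≤ b := by exact_mod_cast hb
    nlinarith
  have hk2 : k - 2 = (b : ℤ) * (t : ℤ) := by rw [hkdef]; ring
  have hkgt : 2 < k := by
    have : (0 : ℤ) < (b : ℤ) * (t : ℤ) := by positivity
    omega
  have hkJ : (2 * J + 3 : ℤ) ≤ k := by omega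
  have htcast : (t : ℤ) = 2 * ((p : ℤ) - 1) * (p : ℤ) ^ e * (t₀ : ℤ) := by
    rw [ht]; push_cast [Nat.cast_sub hp1le]; ring
  have hdiv : (2 * b * (p - 1) * p ^ m : ℤ) ∣ (k - 2) := by
    rw [hk2, htcast, he, pow_add]
    exact ⟨(p : ℤ) ^ m₀ * t₀, by ring⟩
  have hpdiv : ((p : ℤ) - 1) ∣ (k - 2) := by
    rw [hk2, htcast]
    exact ⟨(b : ℤ) * 2 * (p : ℤ) ^ e * t₀, by ring⟩
  have hsk : (b : ℤ) * ((s : ℤ) - 1) = a * (k - 2) := by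
    rw [hk2, hs]; push_cast; ring
  have hsodd : Odd s := ⟨a * ((p - 1) * p ^ e * t₀), by rw [hs, ht]; ring⟩
  have hs0 : 0 < s := hsodd.pos
  have h2s : 2 * (s : ℤ) < k := by
    have hab' : (2 * a : ℤ) < b := by exact_mod_cast hab
    have htpos' : (0 : ℤ) < t := by exact_mod_cast htpos
    have := mul_lt_mul_of_pos_right hab' htpos'
    rw [hkdef, hs]; push_cast; nlinarith
  -- `s ≡ 1 (mod p - 1)`: the trivial Teichmüller branch
  have hps : (s - 1) % (p - 1) = 0 := by
    apply Nat.mod_eq_zero_of_dvd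
    rw [hs, Nat.add_sub_cancel_left, ht]
    exact ⟨a * (2 * p ^ e * t₀), by ring⟩
  -- the branch member of weight `k` (Hida) and its interpolation data
  obtain ⟨g, ι, hnew, hordg, hcong⟩ := hHida W hN p h5 hgood hord k hkgt hpdiv
  obtain ⟨Ω, αk, ω, hΩ, hω, hαnorm, -, hαcong, hval⟩ := hinterp k g ι hkgt hpdiv hnew hordg hcong
  refine ⟨k, g, ι, s, hdiv, hkJ, hsk, hnew, hordg, hcong, fun j hjodd hj3 hjJ => ?_⟩
  have hj0 : 0 < j := by omega
  have h2j : 2 * (j : ℤ) < k := by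
    have : (j : ℤ) ≤ 2 * J + 1 := by exact_mod_cast hjJ
    omega
  have h2j2 : 2 * (j : ℤ) + 2 < k := by
    have : (j : ℤ) ≤ 2 * J + 1 := by exact_mod_cast hjJ
    omega
  -- the two value–norm identities
  obtain ⟨hmems, heqs⟩ := hval s hs0 h2s hsodd
  obtain ⟨hmemj, heqj⟩ := hval j hj0 h2j hjodd
  rw [hps] at heqs
  -- the Euler-type factors have norm one
  have hes := Literature.NumberTheory.EllipticCurves.norm_eulerFactor_eq_one (k := k) hαnorm hαcong hna hsodd h2s
  have hej := Literature.NumberTheory.EllipticCurves.norm_eulerFactor_eq_one (k := k) hαnorm hαcong hna hjodd h2j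
  rw [hes, mul_one] at heqs
  rw [hej, mul_one] at heqj
  -- the points `x_k`, `y_j` lie in the open unit disc; the branch series are integral
  have hxeq : (1 + (p : ℚ_[p])) ^ (k - 2) = ((1 + p : ℕ) : ℚ_[p]) ^ (t * b) := by
    rw [hk2, show (b : ℤ) * (t : ℤ) = ((t * b : ℕ) : ℤ) by push_cast; ring, zpow_natCast]
    simp
  have hx1 : ‖(1 + (p : ℚ_[p])) ^ (k - 2) - 1‖ < 1 := by
    rw [hxeq, stub_normCycPow p hp2 (t * b) (Nat.mul_pos htpos hb)]
    calc (p : ℝ) ^ (-(padicValNat p (t * b) : ℤ) - 1) ≤ (p : ℝ) ^ (-1 : ℤ) :=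
          zpow_le_zpow_right₀ hp1.le (by omega)
      _ < 1 := zpow_lt_one_of_neg₀ hp1 (by norm_num)
  have hyj1 : ‖(1 + (p : ℚ_[p])) ^ (j - 1) - 1‖ < 1 := by
    have : (1 + (p : ℚ_[p])) = ((1 + p : ℕ) : ℚ_[p]) := by push_cast; ring
    rw [this, stub_normCycPow p hp2 (j - 1) (by omega)]
    calc (p : ℝ) ^ (-(padicValNat p (j - 1) : ℤ) - 1) ≤ (p : ℝ) ^ (-1 : ℤ) :=
          zpow_le_zpow_right₀ hp1.le (by omega)
      _ < 1 := zpow_lt_one_of_neg₀ hp1 (by norm_num)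
  have hFj1 : ‖Literature.NumberTheory.EllipticCurves.padicEval₂ (F ((j - 1) % (p - 1)))
      ((1 + (p : ℚ_[p])) ^ (k - 2) - 1) ((1 + (p : ℚ_[p])) ^ (j - 1) - 1)‖ ≤ 1 :=
    Literature.NumberTheory.EllipticCurves.norm_padicEval₂_le_one (hFint _) hx1 hyj1
  -- hence `‖Ω‖ · ‖ι A_j‖ ≤ 1`
  have hΩAj : ‖Ω‖ * ‖ι ⟨_, hmemj⟩‖ ≤ 1 := by rw [← heqj]; exact hFj1
  -- non-vanishing of the denominator `Λ(g, j)`: `2j + 2 < k`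
  have hΛj : Literature.NumberTheory.EllipticCurves.ModularForms.completedLValue g j ≠ 0 :=
    hnew.completedLValue_ne_zero_of_two_mul_add_two_lt hj0 h2j2
  -- the algebraic parts `Cn := i Λ(g,n)/ω ∈ K`
  obtain ⟨a', ha'⟩ := hsodd
  obtain ⟨b', hb'⟩ := hjodd
  have hIa : Complex.I ^ s = (-1) ^ a' * Complex.I := by
    rw [ha', pow_succ, pow_mul, Complex.I_sq]
  have hIb : Complex.I ^ j = (-1) ^ b' * Complex.I := by
    rw [hb', pow_succ, pow_mul, Complex.I_sq]
  have hsgn : ∀ m : ℕ, ((-1 : ℂ) ^ m) ∈ Literature.NumberTheory.EllipticCurves.ModularForms.coeffField g :=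
    fun m ↦ pow_mem (neg_mem (one_mem _)) m
  have hCs : Complex.I * Literature.NumberTheory.EllipticCurves.ModularForms.completedLValue g s / ω ∈
      Literature.NumberTheory.EllipticCurves.ModularForms.coeffField g := by
    have h := mul_mem (hsgn a') hmems
    rwa [hIa, show (-1 : ℂ) ^ a' * ((-1) ^ a' * Complex.I *
        Literature.NumberTheory.EllipticCurves.ModularForms.completedLValue g s / ω) =
      ((-1) ^ a' * (-1) ^ a') * (Complex.I *
        Literature.NumberTheory.EllipticCurves.ModularForms.completedLValue g s / ω) by ring,
      ← pow_add, ← two_mul, pow_mul, neg_one_sq, one_pow, one_mul] at h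
  have hCj : Complex.I * Literature.NumberTheory.EllipticCurves.ModularForms.completedLValue g j / ω ∈
      Literature.NumberTheory.EllipticCurves.ModularForms.coeffField g := by
    have h := mul_mem (hsgn b') hmemj
    rwa [hIb, show (-1 : ℂ) ^ b' * ((-1) ^ b' * Complex.I *
        Literature.NumberTheory.EllipticCurves.ModularForms.completedLValue g j / ω) =
      ((-1) ^ b' * (-1) ^ b') * (Complex.I *
        Literature.NumberTheory.EllipticCurves.ModularForms.completedLValue g j / ω) by ring,
      ← pow_add, ← two_mul, pow_mul, neg_one_sq, one_pow, one_mul] at h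
  have hCj0 : Complex.I * Literature.NumberTheory.EllipticCurves.ModularForms.completedLValue g j / ω ≠ 0 :=
    div_ne_zero (mul_ne_zero Complex.I_ne_zero hΛj) hω
  -- the ratio `R = Λ(g,s)/Λ(g,j) = Cs/Cj ∈ K`
  have hRq : Literature.NumberTheory.EllipticCurves.ModularForms.completedLValue g s /
        Literature.NumberTheory.EllipticCurves.ModularForms.completedLValue g j =
      (Complex.I * Literature.NumberTheory.EllipticCurves.ModularForms.completedLValue g s / ω) /
        (Complex.I * Literature.NumberTheory.EllipticCurves.ModularForms.completedLValue g j / ω) := by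
    field_simp
  have hR : Literature.NumberTheory.EllipticCurves.ModularForms.completedLValue g s /
      Literature.NumberTheory.EllipticCurves.ModularForms.completedLValue g j ∈
      Literature.NumberTheory.EllipticCurves.ModularForms.coeffField g := by
    rw [hRq]; exact div_mem hCs hCj
  refine ⟨hR, ?_⟩
  -- norms: `‖ι R‖ = ‖ι Cs‖ / ‖ι Cj‖`, `‖ι A_s‖ = ‖ι Cs‖`, `‖ι A_j‖ = ‖ι Cj‖`
  have hιinj : Function.Injective ι := ι.injective
  have hquot : (⟨_, hR⟩ : Literature.NumberTheory.EllipticCurves.ModularForms.coeffField g) =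
      (⟨_, hCs⟩ : Literature.NumberTheory.EllipticCurves.ModularForms.coeffField g) / ⟨_, hCj⟩ :=
    Subtype.ext (by push_cast; exact hRq)
  have hAs : (⟨_, hmems⟩ : Literature.NumberTheory.EllipticCurves.ModularForms.coeffField g) =
      (⟨(-1 : ℂ) ^ a', hsgn a'⟩ : Literature.NumberTheory.EllipticCurves.ModularForms.coeffField g) * ⟨_, hCs⟩ :=
    Subtype.ext (by push_cast; rw [hIa]; ring)
  have hAj : (⟨_, hmemj⟩ : Literature.NumberTheory.EllipticCurves.ModularForms.coeffField g) =
      (⟨(-1 : ℂ) ^ b', hsgn b'⟩ : Literature.NumberTheory.EllipticCurves.ModularForms.coeffField g) * ⟨_, hCj⟩ :=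
    Subtype.ext (by push_cast; rw [hIb]; ring)
  have hnegone : ∀ m : ℕ, ‖ι ⟨(-1 : ℂ) ^ m, hsgn m⟩‖ = 1 := by
    intro m
    have : (⟨(-1 : ℂ) ^ m, hsgn m⟩ : Literature.NumberTheory.EllipticCurves.ModularForms.coeffField g) = (-1) ^ m :=
      Subtype.ext (by push_cast; rfl)
    rw [this, map_pow, map_neg, map_one, norm_pow, norm_neg, norm_one, one_pow]
  have hnAs : ‖ι ⟨_, hmems⟩‖ = ‖ι ⟨_, hCs⟩‖ := by
    rw [hAs, map_mul, norm_mul, hnegone, one_mul]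
  have hnAj : ‖ι ⟨_, hmemj⟩‖ = ‖ι ⟨_, hCj⟩‖ := by
    rw [hAj, map_mul, norm_mul, hnegone, one_mul]
  have hιCj : 0 < ‖ι ⟨_, hCj⟩‖ := by
    rw [norm_pos_iff]
    intro h0
    have : (⟨_, hCj⟩ : Literature.NumberTheory.EllipticCurves.ModularForms.coeffField g) = 0 :=
      hιinj (by rw [h0, map_zero])
    exact hCj0 (congrArg Subtype.val this)
  have hΩpos : 0 < ‖Ω‖ := norm_pos_iff.mpr hΩ
  -- `‖ι R‖ ≥ ‖Ω‖ · ‖ι Cs‖ = ‖F_0(x_k, y_s)‖`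
  have hRge : ‖Ω‖ * ‖ι ⟨_, hCs⟩‖ ≤ ‖ι ⟨_, hR⟩‖ := by
    rw [hquot, map_div₀, norm_div, le_div_iff₀ hιCj]
    rw [hnAj] at hΩAj
    calc ‖Ω‖ * ‖ι ⟨_, hCs⟩‖ * ‖ι ⟨_, hCj⟩‖ = ‖ι ⟨_, hCs⟩‖ * (‖Ω‖ * ‖ι ⟨_, hCj⟩‖) := by ring
      _ ≤ ‖ι ⟨_, hCs⟩‖ * 1 := mul_le_mul_of_nonneg_left hΩAj (norm_nonneg _)
      _ = ‖ι ⟨_, hCs⟩‖ := mul_one _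
  -- the lower bound at `t`, dressed back into the crux's coordinates
  have hvt : padicValNat p t = e := by
    have h2p1 : ¬ p ∣ 2 * (p - 1) := by
      intro h
      rcases (Nat.Prime.dvd_mul hp).mp h with h2 | h1
      · exact hp2 ((Nat.prime_dvd_prime_iff_eq hp Nat.prime_two).mp h2)
      · exact absurd (Nat.le_of_dvd (by omega) h1) (by omega)
    have ht₀ndvd : ¬ p ∣ t₀ := by
      intro h
      have h' := Nat.dvd_sub h (Nat.dvd_mul_right p (J + 1))
      rw [ht₀, Nat.add_sub_cancel] at h'
      exact hp.one_lt.ne' (Nat.dvd_one.mp h')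
    rw [ht, padicValNat.mul hpe.ne' ht₀pos.ne', padicValNat.mul (by omega) (by positivity),
      padicValNat.eq_zero_of_not_dvd h2p1, padicValNat.prime_pow,
      padicValNat.eq_zero_of_not_dvd ht₀ndvd]
    ring
  have key := hrate t htpos (by omega)
  -- the double sum of the lower bound IS `padicEval₂ (F 0) x_k y_s`
  have hs1 : s - 1 = t * a := by rw [hs, Nat.add_sub_cancel_left, mul_comm]
  have hcast1p : ((1 + p : ℕ) : ℚ_[p]) = 1 + (p : ℚ_[p]) := by push_cast; ring
  have hsum : ∑' q : ℕ × ℕ, G q.1 q.2 * (((1 + p : ℕ) : ℚ_[p]) ^ (t * b) - 1) ^ q.1 *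
        (((1 + p : ℕ) : ℚ_[p]) ^ (t * a) - 1) ^ q.2 =
      Literature.NumberTheory.EllipticCurves.padicEval₂ (F 0) ((1 + (p : ℚ_[p])) ^ (k - 2) - 1)
        ((1 + (p : ℚ_[p])) ^ (s - 1) - 1) := by
    simp only [hG]
    rw [Literature.NumberTheory.EllipticCurves.tsum_coeff_mul_pow_mul_pow_eq_padicEval₂, hxeq, hs1, hcast1p]
  rw [hsum, heqs, hnAs, hvt] at key
  have hexp : n * (m + 1) + (n * m₀ + C) = n * (e + 1) + C := by rw [he]; ring
  rw [hexp]
  calc (1 : ℝ) ≤ ‖Ω‖ * ‖ι ⟨_, hCs⟩‖ * (p : ℝ) ^ (n * (e + 1) + C) := key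
    _ ≤ ‖ι ⟨_, hR⟩‖ * (p : ℝ) ^ (n * (e + 1) + C) := mul_le_mul_of_nonneg_right hRge (by positivity)

/-- **The bridge from the logical core, all branches** (registered stub `stub_edgeDecay_of_cycOrderLeRank_allBranches`
of skeleton v11): C⁰ (`ord_T L_p ≤ r_an` at one admissible prime with (Br)), modularity (`exists_isNewformOf`), the
all-branches Greenberg–Stevens/Kitagawa value–norm interpolation and Hida's members imply the crux `EdgeDecay` BY
NAME. [folklore] -/
theorem stub_edgeDecay_of_cycOrderLeRank_allBranches :
    (∀ (W : WeierstrassCurve ℚ) [W.IsElliptic] [W.IsGloballyMinimal], 2 ≤ W.analyticRank → (∃ (p₀ : ℕ) (_ : Fact p₀.Prime), 5 ≤ p₀ ∧ W.HasGoodReductionAtPrime p₀ ∧ ¬ (p₀ : ℤ) ∣ W.frobeniusTrace p₀ ∧ W.HasSurjectiveModNGaloisRep p₀) → ∃ (_ : NeZero (W.conductorNorm ℤ)) (p : ℕ) (_ : Fact p.Prime), 5 ≤ p ∧ W.HasGoodReductionAtPrime p ∧ ¬ (p : ℤ) ∣ W.frobeniusTrace p ∧ ¬ (p : ℤ) ∣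 (W.frobeniusTrace p) ^ 2 - 1 ∧ W.HasSurjectiveModNGaloisRep p ∧ (∀ (M : ℕ) (_ : NeZero M) (g : CuspForm (CongruenceSubgroup.Gamma0 M) 2) (ι : Literature.NumberTheory.EllipticCurves.ModularForms.coeffField g →+* PadicAlgCl p), M ∣ W.conductorNorm ℤ * p → Literature.NumberTheory.EllipticCurves.ModularForms.IsNewform0 g → ‖ι ⟨(UpperHalfPlane.qExpansion 1 ⇑g).coeff p, Literature.NumberTheory.EllipticCurves.ModularForms.coeff_mem_coeffField g p⟩‖ = 1 → (∀ ℓ : ℕ, ℓ.Prime → ¬ ℓ ∣ W.conductorNorm ℤ * p → ‖ι ⟨(UpperHalfPlane.qExpansion 1 ⇑g).coeff ℓ, Literature.NumberTheory.EllipticCurves.ModularForms.coeff_mem_coeffField g ℓ⟩ - ((W.frobeniusTrace ℓ : ℤ) : PadicAlgCl p)‖ < 1) → M = W.conductorNorm ℤ ∧ ∀ n : ℕ, (UpperHalfPlane.qExpansion 1 ⇑g).coeff n = ((W.LFunction n : ℤ) : ℂ)) ∧ ∀ (f : CuspForm (CongruenceSubgroup.Gamma0 (W.conductorNorm ℤ))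 2), Literature.NumberTheory.EllipticCurves.ModularForms.IsNewformOf W f → (Literature.NumberTheory.EllipticCurves.padicLFunction f (Literature.NumberTheory.EllipticCurves.unitRoot W p : ℚ_[p])).order ≤ W.analyticRank) → Literature.NumberTheory.EllipticCurves.ModularForms.exists_isNewformOf → Literature.NumberTheory.EllipticCurves.greenbergStevens_kitagawa_twoVariable_interpolation_allBranches → Literature.NumberTheory.EllipticCurves.hida_exists_congruent_ordinary_newform → Summit.BirchSwinnertonDyer.BirchSwinnertonDyer.Theses.TangentCone.EdgeDecay := by
  intro hC hMod hGS hHida W _ _ h2 hp₀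
  obtain ⟨hN, p, hp, h5, hgood, hord, hna, hsurj, hBr, horderAll⟩ := hC W h2 hp₀
  haveI := hp
  haveI := hN
  obtain ⟨f, hf⟩ := hMod W
  obtain ⟨a, b, hb, hab, hJ⟩ :=
    lambdaLayerOne_decayLeCycOrder_allBranches hGS hHida W hN p h5 hgood hord hna hsurj hBr f hf W.analyticRank
      (horderAll f hf)
  exact ⟨hN, p, hp, h5, hgood, hord, hna, hsurj, hBr, a, b, hb, hab, hJ⟩

/-- **C⁺ bridge, all branches** (the card's decidable layer-one unit criterion still feeds the repaired composition):
C⁺ (`LayerOneUnitSomewhere`: at one admissible (Br) prime `p > r_an` some level-`p²` Riemann sum `RS(j,1)` of the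
Mazur–Swinnerton-Dyer measure, `j ≤ r_an`, is a `p`-adic unit) ⇒ C⁰ (`lambdaLayerOne_cycOrderLeRank_of_layerOneUnit`,
landed) ⇒ `EdgeDecay` through the ratio-free bridge — modulo modularity, the all-branches fact and Hida's members.
[folklore] -/
theorem lambdaLayerOne_edgeDecay_of_layerOneUnit_allBranches :
    (∀ (W : WeierstrassCurve ℚ) [W.IsElliptic] [W.IsGloballyMinimal], 2 ≤ W.analyticRank → (∃ (p₀ : ℕ) (_ : Fact p₀.Prime), 5 ≤ p₀ ∧ W.HasGoodReductionAtPrime p₀ ∧ ¬ (p₀ : ℤ) ∣ W.frobeniusTrace p₀ ∧ W.HasSurjectiveModNGaloisRep p₀) → ∃ (_ : NeZero (W.conductorNorm ℤ)) (p : ℕ) (_ : Fact p.Prime), 5 ≤ p ∧ W.HasGoodReductionAtPrime p ∧ ¬ (p : ℤ) ∣ W.frobeniusTrace p ∧ ¬ (p : ℤ) ∣ (W.frobeniusTrace p) ^ 2 - 1 ∧ W.HasSurjectiveModNGaloisRep p ∧ (∀ (M : ℕ) (_ : NeZero M) (g : CuspForm (CongruenceSubgroup.Gamma0 M) 2) (ι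 : Literature.NumberTheory.EllipticCurves.ModularForms.coeffField g →+* PadicAlgCl p), M ∣ W.conductorNorm ℤ * p → Literature.NumberTheory.EllipticCurves.ModularForms.IsNewform0 g → ‖ι ⟨(UpperHalfPlane.qExpansion 1 ⇑g).coeff p, Literature.NumberTheory.EllipticCurves.ModularForms.coeff_mem_coeffField g p⟩‖ = 1 → (∀ ℓ : ℕ, ℓ.Prime → ¬ ℓ ∣ W.conductorNorm ℤ * p → ‖ι ⟨(UpperHalfPlane.qExpansion 1 ⇑g).coeff ℓ, Literature.NumberTheory.EllipticCurves.ModularForms.coeff_mem_coeffField g ℓ⟩ - ((W.frobeniusTrace ℓ : ℤ) : PadicAlgCl p)‖ < 1) → M = W.conductorNorm ℤ ∧ ∀ n : ℕ, (UpperHalfPlane.qExpansion 1 ⇑g).coeff n = ((W.LFunction n : ℤ) : ℂ)) ∧ W.analyticRank < p ∧ ∀ (f : CuspForm (CongruenceSubgroup.Gamma0 (W.conductorNorm ℤ)) 2), Literature.NumberTheory.EllipticCurves.ModularForms.IsNewformOf W f → ∃ j : ℕ, j ≤ W.analyticRank ∧ ‖Literature.NumberTheory.EllipticCurves.padicLRiemannSum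 f (Literature.NumberTheory.EllipticCurves.unitRoot W p : ℚ_[p]) j 1‖ = 1) → Literature.NumberTheory.EllipticCurves.ModularForms.exists_isNewformOf → Literature.NumberTheory.EllipticCurves.greenbergStevens_kitagawa_twoVariable_interpolation_allBranches → Literature.NumberTheory.EllipticCurves.hida_exists_congruent_ordinary_newform → Summit.BirchSwinnertonDyer.BirchSwinnertonDyer.Theses.TangentCone.EdgeDecay :=
  fun hC hMod hGS hHida =>
    stub_edgeDecay_of_cycOrderLeRank_allBranches (lambdaLayerOne_cycOrderLeRank_of_layerOneUnit hC) hMod hGS hHida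

end Summit.BirchSwinnertonDyer.BirchSwinnertonDyer.Theorems
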